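import Literature.NumberTheory.Automorphic.UnitaryGroupNonsplitPlace
import HarnessLib

/-!
# The local unitary group at a NON-SPLIT place in its one-place model: `U(J)(F_v) ≃* U(σ_w, J_w)(E_w)`,
# matching the integral points `U(J)(𝒪_v) ↔ GL_N(𝒪_w)`

Topic `NumberTheory/Automorphic`; namespace `Literature.NumberTheory.Automorphic` (grouping sub-namespace `UnitaryGroup`).
THEOREMS ONLY (no definition, no named fact).  Companion of `UnitaryGroupSplitPlace` (`localPiSplitEquiv`: at a SPLIT
place `U(J)(F_v) ≃ₜ* GL_N(E_w)`) and of `UnitaryGroupNonsplitPlace` (one place above a non-split `v`).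

Setting of `UnitaryGroupLocalFactors`: `E/F` a quadratic extension of number fields with `c ∈ Gal(E/F)`, `c ≠ 1`,
`J ∈ M_N(E)`, a finite place `v` of `F` and a place `w ∣ v` of `E` with `c • w = w` (NON-SPLIT: `v` inert or
ramified).  Then `w` is the only place above `v` (`PlacesOver.eq_of_smul_eq`), the local conjugation is
`σ_w := galAdicCompletionMap c hw : E_w →+* E_w`, and the factor form `U(J)(F_v) = localPi E c N J v ≤ Π_{w' ∣ v} GL_N(E_{w'})`
of the local unitary group is, read at the single index `w`, the matrix group
`U(σ_w, J_w)(E_w) = unitaryGroupOfForm σ_w (placeForm J w) ≤ GL_N(E_w)`: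

* `UnitaryGroup.mem_localPi_iff_of_smul_eq` — `u ∈ U(J)(F_v) ↔ (σ_w u_w)ᵀ · J_w · u_w = J_w` (the fibrewise criterion
  `mem_localPi_iff` at the unique place, the twist `c_* u_{c⁻¹ w}` collapsing to `σ_w u_w` because `c⁻¹ w = w`);
* `UnitaryGroup.mem_localInt_iff_of_smul_eq` — `u ∈ U(J)(𝒪_v) ↔ u_w ∈ GL_N(𝒪_w)`;
* `UnitaryGroup.exists_mulEquiv_localPi_of_smul_eq` — **the one-place model**: a group isomorphism
  `e : U(J)(F_v) ≃* U(σ_w, J_w)(E_w)` with `(e u) = u_w` and `u ∈ U(J)(𝒪_v) ↔ e u ∈ GL_N(𝒪_w)` (evaluation at the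
  unique index, `MulEquiv.piUnique`, restricted to the subgroups);
* `UnitaryGroup.exists_mulEquiv_localPi_unitaryGroupOfForm_of_smul_eq` — the same in the binders, verbatim, of the
  sub-stub (2j) `InertJunction` of the line `b4-hyperspecial-gelfand-pair` (cell `hodgecm-mathlib`, B-plan1 v2
  `d052bd389ad59c7a`), so that the stub closes by `exact`: it is the junction feeding the local symmetric-double-coset
  statement at inert places (`LocalSymmetric`) into `NonsplitBranch` of the named fact `HyperspecialGelfandPair`.

No topology is asserted (the stub asks for `≃*` only; continuity of `u ↦ u_w` is `continuous_apply`).  HC_CM is proved only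
modulo the 7 printed citations until rung 0 of the ladder closes; this file is unconditional and touches no binder (it
serves the rung-0 debt row IV-9).

## References
* [PlatonovRapinchuk1994] V. Platonov, A. Rapinchuk, *Algebraic Groups and Number Theory* (1994), §5.1 (`G_{F_v}`,
  `G_{𝒪_v}` of a matrix realisation; `E ⊗_F F_v = E_w` at a non-split place).
* [CasselsFrohlichANT1967] J. W. S. Cassels, A. Fröhlich (eds.), *Algebraic Number Theory* (1967), Ch. II §10,
  Ch. VII Prop. 1.2.
-/

noncomputable section

open NumberField IsDedekindDomain
open scoped Matrix

namespace Literature.NumberTheory.Automorphic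

namespace UnitaryGroup

variable {F E : Type} [Field F] [NumberField F] [Field E] [NumberField E] [Algebra F E]
  [Algebra.IsQuadraticExtension F E] (c : E ≃ₐ[F] E) (N : ℕ) (J : Matrix (Fin N) (Fin N) E)

/-- **Membership in `U(J)(F_v)` at a non-split place**: for `w ∣ v` with `c • w = w`, a tuple
`u ∈ Π_{w' ∣ v} GL_N(E_{w'})` lies in `U(J)(F_v)` iff its `w`-component is `σ_w`-unitary for `J_w`:
`(σ_w u_w)ᵀ · J_w · u_w = J_w`, `σ_w = galAdicCompletionMap c hw` (the fibrewise criterion `mem_localPi_iff` has a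
single fibre index, and `c⁻¹ • w = w`). [cite: PlatonovRapinchuk1994, §5.1] -/
theorem mem_localPi_iff_of_smul_eq (hc : c ≠ 1) {v : HeightOneSpectrum (𝓞 F)} (w : PlacesOver E v)
    (hw : c • w.1 = w.1) (u : LocalGLPi E N v) :
    u ∈ localPi E c N J v ↔
      (((u w : GL (Fin N) (w.1.adicCompletion E)) : Matrix (Fin N) (Fin N) (w.1.adicCompletion E)).map
            (galAdicCompletionMap (L := E) c hw))ᵀ * placeForm J w.1 *
          ((u w : GL (Fin N) (w.1.adicCompletion E)) : Matrix (Fin N) (Fin N) (w.1.adicCompletion E)) =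
        placeForm J w.1 := by
  -- transport of the twisted factor along an equality of places (the proof inside `galAdicCompletionMap` is irrelevant)
  have key : ∀ (w₁ : PlacesOver E v) (h₁ : c • w₁.1 = w.1),
      ((((u w₁ : GL (Fin N) (w₁.1.adicCompletion E)) : Matrix (Fin N) (Fin N) (w₁.1.adicCompletion E)).map
              (galAdicCompletionMap (L := E) c h₁))ᵀ * placeForm J w.1 *
            ((u w : GL (Fin N) (w.1.adicCompletion E)) : Matrix (Fin N) (Fin N) (w.1.adicCompletion E)) =
          placeForm J w.1) ↔
      ((((u w : GL (Fin N) (w.1.adicCompletion E)) : Matrix (Fin N) (Fin N) (w.1.adicCompletion E)).map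
              (galAdicCompletionMap (L := E) c hw))ᵀ * placeForm J w.1 *
            ((u w : GL (Fin N) (w.1.adicCompletion E)) : Matrix (Fin N) (Fin N) (w.1.adicCompletion E)) =
          placeForm J w.1) := by
    intro w₁ h₁
    obtain rfl : w₁ = w := PlacesOver.eq_of_smul_eq c hc w hw w₁
    exact Iff.rfl
  rw [mem_localPi_iff]
  refine ⟨fun h => (key _ _).mp (h w), fun h w' => ?_⟩
  obtain rfl : w' = w := PlacesOver.eq_of_smul_eq c hc w hw w'
  exact (key _ _).mpr h

/-- **Membership in `U(J)(𝒪_v)` at a non-split place**: `u ∈ U(J)(𝒪_v) ↔ u_w ∈ GL_N(𝒪_w)` (one fibre index).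
[cite: PlatonovRapinchuk1994, §5.1] -/
theorem mem_localInt_iff_of_smul_eq (hc : c ≠ 1) {v : HeightOneSpectrum (𝓞 F)} (w : PlacesOver E v)
    (hw : c • w.1 = w.1) (u : localPi E c N J v) :
    u ∈ localInt E c N J v ↔ (u : LocalGLPi E N v) w ∈ glInt N (w.1.adicCompletion E) := by
  rw [mem_localInt_iff]
  refine ⟨fun h => h w, fun h w' => ?_⟩
  obtain rfl : w' = w := PlacesOver.eq_of_smul_eq c hc w hw w'
  exact h

/-- **The one-place model of `U(J)(F_v)` at a non-split place.**  For `w ∣ v` with `c • w = w` there is a group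
isomorphism `e : U(J)(F_v) ≃* U(σ_w, J_w)(E_w)` (`σ_w = galAdicCompletionMap c hw`, `J_w = placeForm J w`) given by
`u ↦ u_w` — evaluation at the unique place above `v` — under which the integral points correspond:
`u ∈ U(J)(𝒪_v) ↔ e u ∈ GL_N(𝒪_w)`.  (The inert analogue of `localPiSplitEquiv`; `E ⊗_F F_v = E_w`.)
[cite: PlatonovRapinchuk1994, §5.1] -/
theorem exists_mulEquiv_localPi_of_smul_eq (hc : c ≠ 1) {v : HeightOneSpectrum (𝓞 F)} (w : PlacesOver E v)
    (hw : c • w.1 = w.1) :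
    ∃ e : localPi E c N J v ≃* unitaryGroupOfForm (galAdicCompletionMap (L := E) c hw) (placeForm J w.1),
      (∀ g : localPi E c N J v,
          ((e g : unitaryGroupOfForm (galAdicCompletionMap (L := E) c hw) (placeForm J w.1)) :
              GL (Fin N) (w.1.adicCompletion E)) = (g : LocalGLPi E N v) w) ∧
      (∀ g : localPi E c N J v,
          g ∈ localInt E c N J v ↔
            ((e g : unitaryGroupOfForm (galAdicCompletionMap (L := E) c hw) (placeForm J w.1)) :
                GL (Fin N) (w.1.adicCompletion E)) ∈ glInt N (w.1.adicCompletion E)) := by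
  haveI : Subsingleton (PlacesOver E v) := PlacesOver.subsingleton_of_smul_eq c hc w hw
  letI : Unique (PlacesOver E v) := uniqueOfSubsingleton w
  -- evaluation at the unique index `w = default`
  let π : LocalGLPi E N v ≃* GL (Fin N) (w.1.adicCompletion E) :=
    MulEquiv.piUnique fun w' : PlacesOver E v => GL (Fin N) (w'.1.adicCompletion E)
  have hπ : ∀ u : LocalGLPi E N v, π u = u w := fun u => rfl
  -- the image of `U(J)(F_v)` is `U(σ_w, J_w)(E_w)`
  have hmap : (localPi E c N J v).map (π : LocalGLPi E N v →* GL (Fin N) (w.1.adicCompletion E)) =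
      unitaryGroupOfForm (galAdicCompletionMap (L := E) c hw) (placeForm J w.1) := by
    ext g
    rw [mem_unitaryGroupOfForm_iff]
    constructor
    · rintro ⟨u, hu, rfl⟩
      rw [MonoidHom.coe_coe, hπ]
      exact (mem_localPi_iff_of_smul_eq c N J hc w hw u).mp hu
    · intro hg
      refine ⟨π.symm g, (mem_localPi_iff_of_smul_eq c N J hc w hw _).mpr ?_, π.apply_symm_apply g⟩
      have h' : (π.symm g) w = g := π.apply_symm_apply g
      rw [h']
      exact hg
  let e : localPi E c N J v ≃* unitaryGroupOfForm (galAdicCompletionMap (L := E) c hw) (placeForm J w.1) :=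
    (π.subgroupMap (localPi E c N J v)).trans (MulEquiv.subgroupCongr hmap)
  have he : ∀ g : localPi E c N J v,
      ((e g : unitaryGroupOfForm (galAdicCompletionMap (L := E) c hw) (placeForm J w.1)) :
          GL (Fin N) (w.1.adicCompletion E)) = (g : LocalGLPi E N v) w := fun g => rfl
  exact ⟨e, he, fun g => by rw [he, mem_localInt_iff_of_smul_eq c N J hc w hw]⟩

/-- **The one-place model, in the binders of the sub-stub (2j) `InertJunction`** of the line
`b4-hyperspecial-gelfand-pair` (cell `hodgecm-mathlib`; the Hermitian and non-degeneracy hypotheses on `J` are carried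
for the junction and not used): the stub closes by `exact` this. [cite: PlatonovRapinchuk1994, §5.1] -/
theorem exists_mulEquiv_localPi_unitaryGroupOfForm_of_smul_eq (F E : Type) [Field F] [NumberField F] [Field E]
    [NumberField E] [Algebra F E] [Algebra.IsQuadraticExtension F E] (c : E ≃ₐ[F] E) (hc1 : c ≠ 1) (N : ℕ)
    (J : Matrix (Fin N) (Fin N) E) (_hJh : (J.map c)ᵀ = J) (_hJ : IsUnit J.det)
    (v : HeightOneSpectrum (𝓞 F)) (w : PlacesOver E v) (hw : c • w.1 = w.1) :
    ∃ e : localPi E c N J v ≃* unitaryGroupOfForm (galAdicCompletionMap (L := E) c hw) (placeForm J w.1),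
      (∀ g : localPi E c N J v,
          ((e g : unitaryGroupOfForm (galAdicCompletionMap (L := E) c hw) (placeForm J w.1)) :
              GL (Fin N) (w.1.adicCompletion E)) = (g : LocalGLPi E N v) w) ∧
      (∀ g : localPi E c N J v,
          g ∈ localInt E c N J v ↔
            ((e g : unitaryGroupOfForm (galAdicCompletionMap (L := E) c hw) (placeForm J w.1)) :
                GL (Fin N) (w.1.adicCompletion E)) ∈ glInt N (w.1.adicCompletion E)) :=
  exists_mulEquiv_localPi_of_smul_eq c N J hc1 w hw

end UnitaryGroup

end Literature.NumberTheory.Automorphic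

end
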